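import Mathlib.MeasureTheory.Integral.Bochner.Basic
import Mathlib.MeasureTheory.Integral.IntegrableOn

/-!
# Involution identity: pairing `σ_* M − M` with `h` versus with its `σ`-odd part

Helper file for the crux `QuadrupoleSelectionRule` (stmt-CriticalPhenomena-7029), route
`CardyFlipRusso`, sub-problem `CardyFormulaZ2`, line `Sketch` generation 2 ("TransferR2"),
stub T3 "involution identity".

For an involutive measurable role shift `σ` (`σ ∘ σ = id`) on `Θ`, a finite measure `M` on `Θ`
and a bounded measurable real observable `h`, the pairing of the signed measure `σ_* M − M`
with `h` is half its pairing with the `σ`-odd part `h − h ∘ σ` of `h`: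

`∫ h d(σ_* M) − ∫ h dM = ½ · (∫ (h − h ∘ σ) d(σ_* M) − ∫ (h − h ∘ σ) dM)`.

Indeed, with `I₁ = ∫ h d(σ_* M) = ∫ h ∘ σ dM` and `I₀ = ∫ h dM`, involutivity gives
`∫ (h − h ∘ σ) d(σ_* M) = ∫ (h ∘ σ − h) dM = I₁ − I₀` and `∫ (h − h ∘ σ) dM = I₀ − I₁`.
This is the step that makes the disc estimate a *product* of inner and outer smallness.

All statements are elementary measure theory (`integral_map`, `integral_sub`).
-/

noncomputable section

open MeasureTheory

namespace Summit.CriticalPhenomena.CardyFormulaZ2.Theorems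

/-- A bounded measurable real function is integrable against every finite measure.
[folklore] -/
theorem integrable_of_abs_le_of_isFiniteMeasure {Θ : Type*} [MeasurableSpace Θ]
    (μ : Measure Θ) [IsFiniteMeasure μ] (f : Θ → ℝ) (hf : Measurable f) (C : ℝ)
    (hC : ∀ θ, |f θ| ≤ C) : Integrable f μ :=
  Integrable.of_bound hf.aestronglyMeasurable C (ae_of_all _ fun θ => by
    simpa only [Real.norm_eq_abs] using hC θ)

/-- **Involution identity** (stub T3 of line `Sketch`, generation 2, for the crux
`QuadrupoleSelectionRule`).  For an involutive measurable role shift `σ`, the pairing of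
`σ_* M − M` with a bounded measurable observable `h` is half its pairing with the `σ`-odd part
`h − h ∘ σ`. [folklore] -/
theorem integral_map_sub_integral_eq_half_odd {Θ : Type*} [MeasurableSpace Θ] (M : Measure Θ)
    [IsFiniteMeasure M] (σ : Θ → Θ) (hσ : Measurable σ) (hinv : ∀ θ, σ (σ θ) = θ) (h : Θ → ℝ)
    (hh : Measurable h) (hhb : ∃ C, ∀ θ, |h θ| ≤ C) :
    (∫ θ, h θ ∂(M.map σ)) - ∫ θ, h θ ∂M =
      (1 / 2 : ℝ) * ((∫ θ, (h θ - h (σ θ)) ∂(M.map σ)) - ∫ θ, (h θ - h (σ θ)) ∂M) := by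
  obtain ⟨C, hC⟩ := hhb
  -- `h` and `h ∘ σ` are integrable against every finite measure, in particular `M` and `σ_* M`.
  have hsub : ∀ (μ : Measure Θ) [IsFiniteMeasure μ],
      ∫ θ, (h θ - h (σ θ)) ∂μ = (∫ θ, h θ ∂μ) - ∫ θ, h (σ θ) ∂μ := fun μ _ =>
    integral_sub (integrable_of_abs_le_of_isFiniteMeasure μ h hh C hC)
      (integrable_of_abs_le_of_isFiniteMeasure μ (fun θ => h (σ θ)) (hh.comp hσ) C
        fun θ => hC (σ θ))
  -- `I₁ = ∫ h d(σ_* M) = ∫ h ∘ σ dM`.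
  have h1 : ∫ θ, h θ ∂(M.map σ) = ∫ θ, h (σ θ) ∂M :=
    integral_map hσ.aemeasurable hh.aestronglyMeasurable
  -- `∫ h ∘ σ d(σ_* M) = ∫ h ∘ σ ∘ σ dM = ∫ h dM = I₀`, by involutivity.
  have h2 : ∫ θ, h (σ θ) ∂(M.map σ) = ∫ θ, h θ ∂M := by
    rw [integral_map (f := fun θ => h (σ θ)) hσ.aemeasurable (hh.comp hσ).aestronglyMeasurable]
    simp only [hinv]
  rw [hsub (M.map σ), hsub M, h1, h2]
  ring

end Summit.CriticalPhenomena.CardyFormulaZ2.Theorems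

end
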